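import Summits.AtomisticToContinuum.HydrodynamicLimit.Theses.JParityClosure

/-!
Sketch for crux-ideate stmt-AtomisticToContinuum-17608 (ParityBandClosure), ideator k = 1, round 1.
First lemmas of the three idea cards (signatures only; elaboration check).
-/

namespace Summit.AtomisticToContinuum.HydrodynamicLimit.Cruxes.ParityBandClosure.IdeatorOne

open MeasureTheory Real
open Literature.MathematicalPhysics.KineticTheory Literature.Analysis.FluidPDE

/-! ### Card A (plain-entropy-finite-n-bf): the cold-side cross term is dominated by the
hard-sphere Bregman (relative-energy) density with a constant `√(3a/(2θ̃))`, `a` the coldness. -/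

/-- Pointwise anatomy of the Březina–Feireisl cross term at fixed density: for a cell of density
`ρ ≥ 0`, kinetic temperature `θ`, classical temperature `θt` with coldness `a = log(θt/θ) ≥ 2` and
velocity mismatch `w = |u − ũ| ≥ 0`, the cross density `(3/2) ρ a w` is at most
`√(3a/(2θt))` times the relative-energy density `(3/2)ρ(θ − θt − θt log(θ/θt)) + ρ w²/2`.
(AM–GM; the point is the `√a` growth: cells of coldness `≤ A` are absorbed by Gronwall with
constant `e^{C√A t}`, only cold-AND-fast cells are left.) -/
def ColdCrossBound : Prop :=
  ∀ ρ θ θt w : ℝ, 0 ≤ ρ → 0 < θ → 0 < θt → θ ≤ θt * Real.exp (-2) → 0 ≤ w →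
    (3 / 2) * ρ * Real.log (θt / θ) * w ≤
      Real.sqrt (3 * Real.log (θt / θ) / (2 * θt)) *
        ((3 / 2) * ρ * (θ - θt - θt * Real.log (θ / θt)) + ρ * w ^ 2 / 2)

/-- `ColdCrossBound` holds (AM–GM). -/
theorem coldCrossBound_holds : ColdCrossBound := by
  intro ρ θ θt w hρ hθ hθt hcold hw
  set a := Real.log (θt / θ) with ha_def
  -- a ≥ 2
  have hquot : Real.exp 2 ≤ θt / θ := by
    rw [le_div_iff₀ hθ]
    have h1 : Real.exp 2 * θ ≤ Real.exp 2 * (θt * Real.exp (-2)) :=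
      mul_le_mul_of_nonneg_left hcold (Real.exp_pos 2).le
    have h2 : Real.exp 2 * (θt * Real.exp (-2)) = θt := by
      rw [mul_comm, mul_assoc, ← Real.exp_add]; norm_num
    linarith
  have ha2 : 2 ≤ a := by
    rw [ha_def, Real.le_log_iff_exp_le (div_pos hθt hθ)]
    exact hquot
  have ha0 : 0 ≤ a := by linarith
  have hlog : Real.log (θ / θt) = -a := by
    rw [ha_def, ← Real.log_inv, inv_div]
  rw [hlog]
  -- lower bound of the Bregman bracket
  have hB : (3 / 4) * ρ * θt * a + ρ * w ^ 2 / 2 ≤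
      (3 / 2) * ρ * (θ - θt - θt * -a) + ρ * w ^ 2 / 2 := by
    have : θt * a / 2 ≤ θ - θt - θt * -a := by nlinarith
    nlinarith
  set K := Real.sqrt (3 * a / (2 * θt)) with hK
  have hK0 : 0 ≤ K := Real.sqrt_nonneg _
  have hKsq : K ^ 2 = 3 * a / (2 * θt) := by
    rw [hK, Real.sq_sqrt]; positivity
  -- A ≤ K * B₀ by squaring
  have hB0 : 0 ≤ (3 / 4) * ρ * θt * a + ρ * w ^ 2 / 2 := by positivity
  have hA0 : 0 ≤ (3 / 2) * ρ * a * w := by positivity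
  have hsq : ((3 / 2) * ρ * a * w) ^ 2 ≤ (K * ((3 / 4) * ρ * θt * a + ρ * w ^ 2 / 2)) ^ 2 := by
    have hexp : (K * ((3 / 4) * ρ * θt * a + ρ * w ^ 2 / 2)) ^ 2 =
        (3 * a / (2 * θt)) * ((3 / 4) * ρ * θt * a + ρ * w ^ 2 / 2) ^ 2 := by
      rw [mul_pow, hKsq]
    rw [hexp]
    -- (9/4) ρ² a² w² ≤ (3a/(2θt)) ((3/4)ρθt a + ρ w²/2)²; AM-GM: (x+y)² ≥ 4xy
    have hθt' : (0:ℝ) < 2 * θt := by positivity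
    have hrew : 3 * a / (2 * θt) * ((3 / 4) * ρ * θt * a + ρ * w ^ 2 / 2) ^ 2
        = (3 * a * ((3 / 4) * ρ * θt * a + ρ * w ^ 2 / 2) ^ 2) / (2 * θt) := by ring
    rw [hrew, le_div_iff₀ hθt']
    -- key identity: 3a * (x+y)^2 - (3/2 ρ a w)^2 * 2θt = 3a (x - y)^2 where x = 3/4 ρ θt a, y = ρ w²/2
    have key : 3 * a * ((3 / 4) * ρ * θt * a + ρ * w ^ 2 / 2) ^ 2 - ((3 / 2) * ρ * a * w) ^ 2 * (2 * θt)
        = 3 * a * ((3 / 4) * ρ * θt * a - ρ * w ^ 2 / 2) ^ 2 := by ring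
    nlinarith [key, mul_nonneg (by norm_num : (0:ℝ) ≤ 3) (mul_nonneg ha0 (sq_nonneg ((3 / 4) * ρ * θt * a - ρ * w ^ 2 / 2)))]
  have hM0 : 0 ≤ K * ((3 / 4) * ρ * θt * a + ρ * w ^ 2 / 2) := mul_nonneg hK0 hB0
  have hmain : (3 / 2) * ρ * a * w ≤ K * ((3 / 4) * ρ * θt * a + ρ * w ^ 2 / 2) := by
    by_contra h
    push_neg at h
    have := mul_self_lt_mul_self hM0 h
    nlinarith [hsq]
  calc (3 / 2) * ρ * a * w ≤ K * ((3 / 4) * ρ * θt * a + ρ * w ^ 2 / 2) := hmain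
    _ ≤ K * ((3 / 2) * ρ * (θ - θt - θt * -a) + ρ * w ^ 2 / 2) :=
        mul_le_mul_of_nonneg_left hB hK0

/-! ### Card B (entropy-floor-fixes-energy): one-sided isentropic squeeze. -/

/-- The hard-sphere field entropy density `S_σ(ρ, m, e) = ρ (3/2 log θ − log ρ − f_ex(ρσ³))`,
`θ = (2/3)(e/ρ − |m|²/(2ρ²))`, with the junk value `0` off `{ρ > 0, θ > 0}` (same convention as
`LocalSecondLaw`'s `Hs = −S_σ`). -/
noncomputable def fieldEntropy (σ ρ : ℝ) (m : V3) (e : ℝ) : ℝ :=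
  let θ := 2 / 3 * (e / ρ - ‖m‖ ^ 2 / (2 * ρ ^ 2))
  if 0 < ρ ∧ 0 < θ then ρ * (3 / 2 * Real.log θ - Real.log ρ - hsExcessFreeEnergy (ρ * σ ^ 3)) else 0

/-- POINTWISE SQUEEZE (tangent inequality of the concave map `e ↦ S_σ(ρ,m,e)` at the energy
`ê = ρ(3/2 θt + |m|²/(2ρ²))` whose temperature is `θt`; slope `∂S/∂e = 1/θ`):
`θt · S_σ(ρ,m,e) ≤ θt · ρ s_σ(ρ, θt) + (e − ê)`. It is `log x ≤ x − 1`. -/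
theorem fieldEntropy_le_tangent (σ ρ θt e : ℝ) (m : V3) (hρ : 0 < ρ) (hθt : 0 < θt)
    (hθ : 0 < 2 / 3 * (e / ρ - ‖m‖ ^ 2 / (2 * ρ ^ 2))) :
    θt * fieldEntropy σ ρ m e ≤
      θt * (ρ * (3 / 2 * Real.log θt - Real.log ρ - hsExcessFreeEnergy (ρ * σ ^ 3))) +
        (e - ρ * (3 / 2 * θt + ‖m‖ ^ 2 / (2 * ρ ^ 2))) := by
  set θ := 2 / 3 * (e / ρ - ‖m‖ ^ 2 / (2 * ρ ^ 2)) with hθdef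
  have hS : fieldEntropy σ ρ m e =
      ρ * (3 / 2 * Real.log θ - Real.log ρ - hsExcessFreeEnergy (ρ * σ ^ 3)) := by
    simp only [fieldEntropy]
    rw [if_pos ⟨hρ, hθ⟩]
  rw [hS]
  -- `log (θ/θt) ≤ θ/θt - 1`
  have hlog : Real.log θ - Real.log θt ≤ θ / θt - 1 := by
    rw [← Real.log_div hθ.ne' hθt.ne']
    exact Real.log_le_sub_one_of_pos (div_pos hθ hθt)
  have he : e = ρ * (3 / 2 * θ + ‖m‖ ^ 2 / (2 * ρ ^ 2)) := by
    rw [hθdef]; field_simp; ring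
  rw [he]
  have key : θt * (ρ * (3 / 2 * Real.log θ)) ≤ θt * (ρ * (3 / 2 * Real.log θt)) + ρ * (3 / 2) * (θ - θt) := by
    have h1 : θt * (ρ * (3 / 2)) * (Real.log θ - Real.log θt) ≤ θt * (ρ * (3 / 2)) * (θ / θt - 1) :=
      mul_le_mul_of_nonneg_left hlog (by positivity)
    have h2 : θt * (ρ * (3 / 2)) * (θ / θt - 1) = ρ * (3 / 2) * (θ - θt) := by
      field_simp
    nlinarith [h1, h2]
  nlinarith [key]

/-- ONE-SIDED SQUEEZE, integrated form (the reduction lemma of card B, deterministic, no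
dynamics): at a fixed time, a `ψθ̃`-weighted entropy floor + strong density convergence + the
convexity `liminf` of the bulk kinetic energy `|m|²/(2ρ)` + the exact total energy give the LOWER
bound `∫ψ e_n ≥ ∫ψ Ẽ − o(1)`; with `ψ ↦ 1 − ψ` and the exact total this is two-sided, i.e. the
energy conjunct of `TendstoHydroFieldsAt` at that time. Stated for one index with explicit slack. -/
def OneSidedSqueeze : Prop :=
  ∀ (σ : ℝ) (ψ θt ρt : T3 → ℝ) (ut : T3 → V3) (ρn en : T3 → ℝ) (mn : T3 → V3) (ε₁ ε₂ ε₃ : ℝ),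
    Continuous ψ → (∀ x, 0 ≤ ψ x) → Continuous θt → (∀ x, 0 < θt x) → Continuous ρt →
    (∀ x, 0 < ρt x) → Continuous ut →
    (∀ x, 0 < ρn x) → (∀ x, 0 < 2 / 3 * (en x / ρn x - ‖mn x‖ ^ 2 / (2 * ρn x ^ 2))) →
    Integrable (fun x => ψ x * θt x * fieldEntropy σ (ρn x) (mn x) (en x)) →
    Integrable (fun x => ψ x * en x) → Integrable (fun x => ψ x * ‖mn x‖ ^ 2 / (2 * ρn x)) →
    Integrable (fun x => ψ x * θt x * ρn x) →
    Integrable (fun x => ψ x * θt x * (ρn x * (3 / 2 * Real.log (θt x) - Real.log (ρn x) -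
      hsExcessFreeEnergy (ρn x * σ ^ 3)))) →
    -- (i) entropy floor at this time, weight ψθ̃ (the classical state has temperature θt):
    (∫ x, ψ x * θt x * (fieldEntropy σ (ρn x) (mn x) (en x) -
        fieldEntropy σ (ρt x) (ρt x • ut x) (totalEnergyDensity (ρt x) (ut x) (θt x))) ≥ -ε₁) →
    -- (ii) density term (strong convergence of ρ_n, continuity of ρ ↦ ρ s_σ(ρ, θt)):
    (∫ x, ψ x * θt x * (ρt x * (3 / 2 * Real.log (θt x) - Real.log (ρt x) -
          hsExcessFreeEnergy (ρt x * σ ^ 3)) -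
        ρn x * (3 / 2 * Real.log (θt x) - Real.log (ρn x) - hsExcessFreeEnergy (ρn x * σ ^ 3))) ≥ -ε₂) →
    (∫ x, ψ x * (3 / 2) * θt x * (ρn x - ρt x) ≥ -ε₂) →
    -- (iii) liminf of the bulk kinetic energy (convexity of (ρ,m) ↦ |m|²/ρ under weak convergence):
    (∫ x, ψ x * ‖mn x‖ ^ 2 / (2 * ρn x) ≥ (∫ x, ψ x * (ρt x * ‖ut x‖ ^ 2 / 2)) - ε₃) →
    (∫ x, ψ x * en x) ≥ (∫ x, ψ x * totalEnergyDensity (ρt x) (ut x) (θt x)) - (ε₁ + 2 * ε₂ + ε₃)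

/-! ### Card C (transfer-weighted-parity-chain): collision-invariant rigidity survives the removal
of grazing collisions, so the parity chain can run on the `(g·n̂)₊`-weighted (non-grazing) contact
measure, which is tight by the trace of `EvenStressEnskog` — no `CollisionTightness`. -/

/-- `ParityRigidity` with the grazing set cut away: if for EVERY `a > 0` the even production of
the `ϑ`-mollified law against the kernel `((w−v)·ω)₊ · min(1, ((w−v)·ω)₊/a)` tends to `0` as
`ϑ → 0⁺`, the law is a point mass or a Maxwellian. (Two non-grazing reflections reach every
non-grazing pair on the momentum–energy sphere, so the restricted functional equation already
forces a collision invariant; the cut kernels increase to the full one.) -/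
def ParityRigidityNonGrazing : Prop :=
  ∀ (m : Measure V3) [IsProbabilityMeasure m], Integrable (fun v => ‖v‖ ^ 2) m →
    (let h : ℝ → V3 → ℝ := fun ϑ v => ∫ v', localMaxwellian 1 (ϑ ^ 2) v v' ∂m
     let F : ℝ → Metric.sphere (0 : V3) 1 → V3 × V3 → ℝ := fun ϑ ω p =>
       Real.log (h ϑ p.1) + Real.log (h ϑ p.2) - Real.log (h ϑ (collide ω p).1) -
         Real.log (h ϑ (collide ω p).2)
     ∀ a : ℝ, 0 < a →
       Filter.Tendsto (fun ϑ : ℝ => ∫⁻ p, ∫⁻ ω,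
         ENNReal.ofReal (hardSphereKernel (p.2, p.1) ω * min 1 (hardSphereKernel (p.2, p.1) ω / a) *
           (F ϑ ω p * (1 - Real.exp (-F ϑ ω p)))) ∂sphereMeasure ∂(m.prod m))
         (nhdsWithin 0 (Set.Ioi 0)) (nhds 0)) →
    (∃ u : V3, m = Measure.dirac u) ∨
      (∃ θ : ℝ, ∃ u : V3, 0 < θ ∧
        m = volume.withDensity (fun v => ENNReal.ofReal (localMaxwellian 1 θ u v)))

/-- Sanity: the non-grazing rigidity implies the route's `ParityRigidity`-type conclusion is
reachable from cut statistics — bookkeeping direction only (the full kernel dominates each cut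
kernel, so full production → 0 gives every cut production → 0). -/
theorem cutKernel_le_full (a k : ℝ) (ha : 0 < a) (hk : 0 ≤ k) : k * min 1 (k / a) ≤ k := by
  have : min 1 (k / a) ≤ 1 := min_le_left _ _
  nlinarith [this, hk]

/-! ### Typed residual stubs (what X does not contain; both are STUBS of a line, or route-level repairs) -/

/-- Card B stub/repair target (NOT in X): **fixed-time local entropy floor** — at a fixed time
`t < T`, for every continuous `ψ ≥ 0`, the `ψ·θ(t,·)`-weighted field entropy of the `r`-mollified
empirical fields is whp not below its classical value (which equals its transported initial value:
classical solutions are isentropic). The fixed-time shadow of `LocalSecondLaw`; with the one-sided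
squeeze (`OneSidedSqueeze`, `fieldEntropy_le_tangent`) and exact energy conservation it yields the
ENERGY conjunct of `TendstoHydroFieldsAt` at time `t` with no cubic tails and no energy-transfer
mark. Same `Hs`, `ρm`, `θm` as `LocalSecondLaw`; `N → ∞` before `r → 0`. -/
def EntropyNoDipAt : Prop :=
  ∀ (a₀ θ₀ : Literature.MathematicalPhysics.KineticTheory.T3 → ℝ) (u₀ : Literature.MathematicalPhysics.KineticTheory.T3 → Literature.MathematicalPhysics.KineticTheory.V3), Continuous a₀ → Continuous θ₀ → Continuous u₀ → (∀ x, 0 < a₀ x) → (∀ x, 0 < θ₀ x) → ∃ σ₀ : ℝ, 0 < σ₀ ∧ ∀ σ : ℝ, 0 < σ → σ < σ₀ → ∀ (T : ℝ) (ρ θ : ℝ → Literature.MathematicalPhysics.KineticTheory.T3 → ℝ) (u : ℝ → Literature.MathematicalPhysics.KineticTheory.T3 → Literature.MathematicalPhysics.KineticTheory.V3), Literature.MathematicalPhysics.KineticTheory.IsHardSphereEulerSolution σ T ρ u θ → ∀ Φ : (N : ℕ) → Literature.Analysis.FluidPDE.HardSphereFlow (Literature.Analysis.FluidPDE.Torus.geometry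 (Fin 3)) (Literature.MathematicalPhysics.KineticTheory.hsDiameter σ N) (N + 1), Literature.MathematicalPhysics.KineticTheory.TendstoHydroFieldsAt (fun N => Literature.MathematicalPhysics.KineticTheory.localGibbsLaw σ a₀ u₀ θ₀ N (Φ N)) Φ ρ u θ 0 → 0 < T → ∀ t ∈ Set.Ico (0:ℝ) T, ∀ ψ : Literature.MathematicalPhysics.KineticTheory.T3 → ℝ, Continuous ψ → (∀ x, 0 ≤ ψ x) → ∀ η δ : ℝ, 0 < η → 0 < δ → ∃ r₀ : ℝ, 0 < r₀ ∧ ∀ r : ℝ, 0 < r → r < r₀ → ∃ N₀ : ℕ, ∀ N : ℕ, N₀ ≤ N → let γ : Literature.Analysis.FluidPDE.Config (N + 1) (Fin 3) Literature.MathematicalPhysics.KineticTheory.T3 → ℝ → Literature.Analysis.FluidPDE.Config (N + 1) (Fin 3) Literature.MathematicalPhysics.KineticTheory.T3 := fun z s => (Φ N).flow s z; let bx : Literature.MathematicalPhysics.KineticTheory.T3 → Literature.MathematicalPhysics.KineticTheory.T3 → ℝ := fun x y => 3 / (Real.pi * r ^ 3) * max (1 - Literature.Analysis.FluidPDE.Torus.euclidDist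 x y / r) 0; let ρm : Literature.Analysis.FluidPDE.Config (N + 1) (Fin 3) Literature.MathematicalPhysics.KineticTheory.T3 → ℝ → Literature.MathematicalPhysics.KineticTheory.T3 → ℝ := fun z s x₀ => ∫ q, bx q.1 x₀ ∂(Literature.Analysis.FluidPDE.empiricalMeasure (γ z s)); let mm : Literature.Analysis.FluidPDE.Config (N + 1) (Fin 3) Literature.MathematicalPhysics.KineticTheory.T3 → ℝ → Literature.MathematicalPhysics.KineticTheory.T3 → Literature.MathematicalPhysics.KineticTheory.V3 := fun z s x₀ => ∫ q, bx q.1 x₀ • q.2 ∂(Literature.Analysis.FluidPDE.empiricalMeasure (γ z s)); let em : Literature.Analysis.FluidPDE.Config (N + 1) (Fin 3) Literature.MathematicalPhysics.KineticTheory.T3 → ℝ → Literature.MathematicalPhysics.KineticTheory.T3 → ℝ := fun z s x₀ => ∫ q, bx q.1 x₀ * (‖q.2‖ ^ 2 / 2) ∂(Literature.Analysis.FluidPDE.empiricalMeasure (γ z s)); let θm : Literature.Analysis.FluidPDE.Config (N + 1) (Fin 3) Literature.MathematicalPhysics.KineticTheory.T3 → ℝ → Literature.MathematicalPhysics.KineticTheory.T3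 → ℝ := fun z s x₀ => 2 / 3 * (em z s x₀ / ρm z s x₀ - ‖mm z s x₀‖ ^ 2 / (2 * ρm z s x₀ ^ 2)); let Hs : ℝ → ℝ → ℝ := fun a b => if 0 < a ∧ 0 < b then -(a * (3 / 2 * Real.log b - Real.log a - Literature.MathematicalPhysics.KineticTheory.hsExcessFreeEnergy (a * σ ^ 3))) else 0; Literature.MathematicalPhysics.KineticTheory.localGibbsLaw σ a₀ u₀ θ₀ N (Φ N) {z | (∫ x : Literature.MathematicalPhysics.KineticTheory.T3, ψ x * θ t x * (Hs (ρ t x) (θ t x) - Hs (ρm z t x) (θm z t x))) < -η} ≤ ENNReal.ofReal δ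


/-- Card A residual stub (NOT in X): **log²-integrability of coldness** — before the shock, the
space-time integral of `ρ_r · [log(θ(s,x)/θ_r)]₊²` (empirical density times squared coldness
relative to the classical temperature) is bounded in probability, uniformly as `N → ∞` then
`r → 0`. `LocalSecondLaw` controls the same quantity with exponent 1 only; exponent 2 is what makes
the Březina–Feireisl cross term `∫∫ ρ (s̃ − s)(u − ũ)·∇θ̃` on cold-and-fast cells Gronwall-absorbable
with the PLAIN second law (`ColdCrossBound`). -/
def ColdnessLogSquare : Prop :=
  ∀ (a₀ θ₀ : Literature.MathematicalPhysics.KineticTheory.T3 → ℝ) (u₀ : Literature.MathematicalPhysics.KineticTheory.T3 → Literature.MathematicalPhysics.KineticTheory.V3), Continuous a₀ → Continuous θ₀ → Continuous u₀ → (∀ x, 0 < a₀ x) → (∀ x, 0 < θ₀ x) → ∃ σ₀ : ℝ, 0 < σ₀ ∧ ∀ σ : ℝ, 0 < σ → σ < σ₀ → ∀ (T : ℝ) (ρ θ : ℝ → Literature.MathematicalPhysics.KineticTheory.T3 → ℝ) (u : ℝ → Literature.MathematicalPhysics.KineticTheory.T3 → Literature.MathematicalPhysics.KineticTheory.V3),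 Literature.MathematicalPhysics.KineticTheory.IsHardSphereEulerSolution σ T ρ u θ → ∀ Φ : (N : ℕ) → Literature.Analysis.FluidPDE.HardSphereFlow (Literature.Analysis.FluidPDE.Torus.geometry (Fin 3)) (Literature.MathematicalPhysics.KineticTheory.hsDiameter σ N) (N + 1), Literature.MathematicalPhysics.KineticTheory.TendstoHydroFieldsAt (fun N => Literature.MathematicalPhysics.KineticTheory.localGibbsLaw σ a₀ u₀ θ₀ N (Φ N)) Φ ρ u θ 0 → 0 < T → ∀ τ : ℝ, 0 < τ → τ < T → ∀ δ : ℝ, 0 < δ → ∃ C : ℝ, ∃ r₀ : ℝ, 0 < r₀ ∧ ∀ r : ℝ, 0 < r → r < r₀ → ∃ N₀ : ℕ, ∀ N : ℕ, N₀ ≤ N → let γ : Literature.Analysis.FluidPDE.Config (N + 1) (Fin 3) Literature.MathematicalPhysics.KineticTheory.T3 → ℝ → Literature.Analysis.FluidPDE.Config (N + 1) (Fin 3) Literature.MathematicalPhysics.KineticTheory.T3 := fun z s => (Φ N).flow s z; let bx : Literature.MathematicalPhysics.KineticTheory.T3 → Literature.MathematicalPhysics.KineticTheory.T3 → ℝ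 := fun x y => 3 / (Real.pi * r ^ 3) * max (1 - Literature.Analysis.FluidPDE.Torus.euclidDist x y / r) 0; let ρm : Literature.Analysis.FluidPDE.Config (N + 1) (Fin 3) Literature.MathematicalPhysics.KineticTheory.T3 → ℝ → Literature.MathematicalPhysics.KineticTheory.T3 → ℝ := fun z s x₀ => ∫ q, bx q.1 x₀ ∂(Literature.Analysis.FluidPDE.empiricalMeasure (γ z s)); let mm : Literature.Analysis.FluidPDE.Config (N + 1) (Fin 3) Literature.MathematicalPhysics.KineticTheory.T3 → ℝ → Literature.MathematicalPhysics.KineticTheory.T3 → Literature.MathematicalPhysics.KineticTheory.V3 := fun z s x₀ => ∫ q, bx q.1 x₀ • q.2 ∂(Literature.Analysis.FluidPDE.empiricalMeasure (γ z s)); let em : Literature.Analysis.FluidPDE.Config (N + 1) (Fin 3) Literature.MathematicalPhysics.KineticTheory.T3 → ℝ → Literature.MathematicalPhysics.KineticTheory.T3 → ℝ := fun z s x₀ => ∫ q, bx q.1 x₀ * (‖q.2‖ ^ 2 / 2) ∂(Literature.Analysis.FluidPDE.empiricalMeasure (γ z s)); let θm : Literature.Analysis.FluidPDE.Config (N + 1)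 (Fin 3) Literature.MathematicalPhysics.KineticTheory.T3 → ℝ → Literature.MathematicalPhysics.KineticTheory.T3 → ℝ := fun z s x₀ => 2 / 3 * (em z s x₀ / ρm z s x₀ - ‖mm z s x₀‖ ^ 2 / (2 * ρm z s x₀ ^ 2)); let Hs : ℝ → ℝ → ℝ := fun a b => if 0 < a ∧ 0 < b then -(a * (3 / 2 * Real.log b - Real.log a - Literature.MathematicalPhysics.KineticTheory.hsExcessFreeEnergy (a * σ ^ 3))) else 0; Literature.MathematicalPhysics.KineticTheory.localGibbsLaw σ a₀ u₀ θ₀ N (Φ N) {z | C < ∫ s in Set.Icc (0 : ℝ) τ, ∫ x : Literature.MathematicalPhysics.KineticTheory.T3, ρm z s x * (max (Real.log (θ s x / θm z s x)) 0) ^ 2} ≤ ENNReal.ofReal δ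

end Summit.AtomisticToContinuum.HydrodynamicLimit.Cruxes.ParityBandClosure.IdeatorOne
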